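import Mathlib
import Summits.Ventures.PercRepro2.SwOutMixedCoreFlipGeneric
import Summits.Ventures.PercRepro2.SwOutMixedArmsBaseEdges

/-!
# The several-arms base: the generic moves (G3, the general case) (blind cell PercRepro2, night-4
g20, 2026-08-27; proofs/NIGHT4-G20.md §4′)

For cube points `q' ≤ q`, both non-leaking on both sides, the edges turned from red to blue lie in
the classes whose coordinate dropped (`turned_blue_class`: a u-arm, a piece, a far arm, or the
u–p_r edges of an arm; the outside edges only turn red), so the landed generic move principle
`mem_tgtU_of_turned_blue` (pure graph theory) gives: the conditioning is kept
(`mem_tgtU_of_le`) — provided every u–p_r class that turns blue does so while some u-arm is red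
at `q` and some u-arm blue at `q'`.  The remaining raw-lower moves — an attached arm dropped at
`s = ⊤`, a red-attached arm turned blue-attached at `s = ⊥` — have NO several-arms twin of g18's
`SwOutMixedCoreMoveUP`: with a second arm `u` is blue-joined to every dropped vertex, and the drop
of an arm merges the blue component of `l` with that of `u`; the pulled-back conditioning is not
block-lower (7-vertex counterexample, NIGHT4-G20.md §4″).  The single-arm twin of this file is
`SwOutMixedCoreFlipGeneric`.
-/

namespace Summit.Ventures.PercRepro2

namespace MixedArms

open Hull LocRows BigBlock

variable {V : Type*} {E : Type*}

open scoped Classical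

section Moves

variable {ends : E → Sym2 V} {σ : Config E} {h u : V} {ι ρ ν κ : Type*} {U : ι → Set V}
  {p : ρ → V} {Ah : ν → Set V} {arm : ν → ρ} {F : κ → Set V}
  (hb : MixedBaseR ends σ h u U p Ah arm F)
include hb

/-- An edge turned from red to blue between `q' ≤ q` lies in a class whose coordinate dropped. -/
lemma MixedBaseR.turned_blue_class {q q' : PtR ι ρ ν κ} (hle : q' ≤ q) {e : E}
    (h1 : mixedRealR ends u U p Ah F σ q e = true)
    (h2 : mixedRealR ends u U p Ah F σ q' e = false) :
    (∃ j, q.1 j = true ∧ q'.1 j = false ∧ e ∈ touches ends (U j)) ∨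
      (∃ i, q.2.1 i = true ∧ q'.2.1 i = false ∧ e ∈ touches ends (Ah i)) ∨
      (∃ r, q.2.2.1 r = true ∧ q'.2.2.1 r = false ∧ e ∈ clsUPR ends u p r) ∨
      (∃ k, q.2.2.2.2 k = true ∧ q'.2.2.2.2 k = false ∧ e ∈ touches ends (F k)) := by
  obtain ⟨hs, ha, huP, he, hf⟩ := hle
  by_cases hU : ∃ j, e ∈ touches ends (U j)
  · obtain ⟨j, hj⟩ := hU
    left
    refine ⟨j, ?_⟩
    rw [hb.mixedRealR_apply_U hj] at h1 h2
    have hsj := Bool.le_iff_imp.1 (hs j)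
    cases hq : q.1 j <;> cases hq' : q'.1 j <;> rw [hq] at h1 <;> rw [hq'] at h2 <;> simp_all
  by_cases hA : ∃ i, e ∈ touches ends (Ah i)
  · obtain ⟨i, hi⟩ := hA
    right
    left
    refine ⟨i, ?_⟩
    rw [hb.mixedRealR_apply_Ah hi] at h1 h2
    have hai := Bool.le_iff_imp.1 (ha i)
    cases hq : q.2.1 i <;> cases hq' : q'.2.1 i <;> rw [hq] at h1 <;> rw [hq'] at h2 <;> simp_all
  by_cases hUP : ∃ r, e ∈ clsUPR ends u p r
  · obtain ⟨r, hr⟩ := hUP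
    right
    right
    left
    refine ⟨r, ?_⟩
    rw [hb.mixedRealR_apply_UP hr] at h1 h2
    have hur := Bool.le_iff_imp.1 (huP r)
    cases hq : q.2.2.1 r <;> cases hq' : q'.2.2.1 r <;> rw [hq] at h1 <;> rw [hq'] at h2 <;>
      simp_all
  by_cases hF : ∃ k, e ∈ touches ends (F k)
  · obtain ⟨k, hk⟩ := hF
    right
    right
    right
    refine ⟨k, ?_⟩
    rw [hb.mixedRealR_apply_F hk] at h1 h2
    have hfk := Bool.le_iff_imp.1 (hf k)
    cases hq : q.2.2.2.2 k <;> cases hq' : q'.2.2.2.2 k <;> rw [hq] at h1 <;> rw [hq'] at h2 <;>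
      simp_all
  by_cases hX : ∃ r, e ∈ clsExtR ends u p Ah r
  · exfalso
    obtain ⟨r, hr⟩ := hX
    rw [hb.mixedRealR_apply_Ext hr] at h1 h2
    obtain ⟨x, hpx, hxu, hxA⟩ := hr
    have hσ := hb.ext_blue r e x hpx hxu hxA
    have her := Bool.le_iff_imp.1 (he r)
    cases hq : q.2.2.2.1 r <;> cases hq' : q'.2.2.2.1 r <;> rw [hq] at h1 <;> rw [hq'] at h2 <;>
      simp_all
  · exfalso
    simp only [not_exists] at hU hA hUP hF hX
    rw [MixedBaseR.mixedRealR_apply_none hU hA hUP hX hF] at h1 h2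
    rw [h1] at h2
    exact absurd h2 (by decide)

/-- **The generic move of the several-arms base**: for cube points `q' ≤ q`, both non-leaking on
both sides, the conditioning is kept — provided every u–p class that turns blue does so with some
u-arm red at `q` and some u-arm blue at `q'`. -/
theorem MixedBaseR.mem_tgtU_of_le [Fintype E] [DecidableEq E]
    (hup : ∀ r, ∃ e, ends e = s(u, p r)) {Us : Set V} {l o : V}
    (hUs : {h} ∪ {u} ∪ Set.range p ∪ armsAllR U Ah F ⊆ Us) (hl : l ∉ Us)
    {q q' : PtR ι ρ ν κ} (hle : q' ≤ q) (hqR : ¬ LeakRR arm q) (hqB' : ¬ LeakBR arm q')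
    (hR' : ¬ LeakRR arm q')
    (huP : ∀ r, q'.2.2.1 r = q.2.2.1 r ∨ ((∃ j, q.1 j = true) ∧ ∃ j, q'.1 j = false))
    (hQ : mixedRealR ends u U p Ah F σ q ∈ tgtU ends l h {S : Set V | o ∈ S}) :
    mixedRealR ends u U p Ah F σ q' ∈ tgtU ends l h {S : Set V | o ∈ S} := by
  refine mem_tgtU_of_turned_blue
    (fun hl' => hl (hUs (hb.hull_mixedRealR_subset hup hR' hqB' hl'))) ?_ ?_ hQ
  · -- an end in the red cluster of `h` at `q`
    intro e h1 h2
    rw [hb.cluster_mixedRealR hup hqR]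
    rcases hb.turned_blue_class hle h1 h2 with ⟨j, hj, _, x, hx, y, hxy⟩ |
      ⟨i, hi, _, x, hx, y, hxy⟩ | ⟨r, hP, hP', hUP⟩ | ⟨k, hk, _, x, hx, y, hxy⟩
    · exact ⟨x, y, hxy, (hb.mem_redSetR_U hx).2 hj⟩
    · exact ⟨x, y, hxy, (hb.mem_redSetR_Ah hx).2 hi⟩
    · refine ⟨u, p r, hUP, hb.mem_redSetR_u.2 ?_⟩
      rcases huP r with huPr | ⟨hs, _⟩
      · rw [huPr, hP] at hP'
        exact absurd hP' (by decide)
      · exact hs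
    · exact ⟨x, y, hxy, (hb.mem_redSetR_F hx).2 hk⟩
  · -- an end in the blue cluster of `h` at `q'`
    intro e h1 h2
    rw [hb.cluster_blue_mixedRealR hup hqB']
    rcases hb.turned_blue_class hle h1 h2 with ⟨j, _, hj', x, hx, y, hxy⟩ |
      ⟨i, _, hi', x, hx, y, hxy⟩ | ⟨r, hP, hP', hUP⟩ | ⟨k, _, hk', x, hx, y, hxy⟩
    · refine ⟨x, y, hxy, (hb.mem_redSetR_U hx).2 ?_⟩
      simp [flipPt, flipAll, hj']
    · refine ⟨x, y, hxy, (hb.mem_redSetR_Ah hx).2 ?_⟩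
      simp [flipPt, flipAll, hi']
    · refine ⟨u, p r, hUP, hb.mem_redSetR_u.2 ?_⟩
      rcases huP r with huPr | ⟨_, j, hj⟩
      · rw [huPr, hP] at hP'
        exact absurd hP' (by decide)
      · exact ⟨j, by simp [flipPt, flipAll, hj]⟩
    · refine ⟨x, y, hxy, (hb.mem_redSetR_F hx).2 ?_⟩
      simp [flipPt, flipAll, hk']

end Moves

end MixedArms

end Summit.Ventures.PercRepro2
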